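import Summits.BirchSwinnertonDyer.BirchSwinnertonDyer.Theorems.ThetaPartnerAtTwoMazurTateCongruenceAtTwoTopDepletionPrimitiveOfIhara
import Summits.BirchSwinnertonDyer.BirchSwinnertonDyer.Theorems.ThetaPartnerAtTwoMazurTateCongruenceAtTwoRMuInvariance
import HarnessLib

/-!
# Crux `MazurTateCongruenceAtTwoTop` (stmt-BirchSwinnertonDyer-25797 = `MazurTateCongruenceAtTwoR` 21416), line `symbol` v6:
# THE CRUX BY NAME from PUB⁴ + the period fact + (IH₂⁻) «Ihara's lemma mod 2, symbol form» ALONE, and Greenberg–Vatsal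
# `μ`-invariance at `2` on the theta habitat as a COROLLARY (lead prover bsd-wall-tp2-p1 g11; `--supports stmt-BirchSwinnertonDyer-25797`)

HONEST FRAMING. THEOREMS ONLY. The named Literature facts and (IH₂⁻) are explicit HYPOTHESES; nothing about their truth is asserted;
BSD is not proved by any of this.

WHAT. The `closes`-binder shape of skeleton `symbol` v6 with its landed plumbing inlined:
`mazurTateCongruenceAtTwoTop_of_fourFacts_ihara (hES hSD hBz hSe) (h2) (hIH)` =
`…_of_fourFacts_depletionPrimitiveNegDisc` (p629892) ∘ `stub_depletionPrimitiveNegDisc_of_ihara` (p630314); five-fact form with Abbes–Ullmo;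
twin 21416; and `muInvarianceAtTwo_of_fourFacts_ihara`: (μ-INV₂) «`L♭_W` has a unit coefficient iff `L♭_A` does, for every theta pair» from the
same inputs, through the lead's converse `flatIff_of_mazurTateCongruenceAtTwoTop` (p626036). So on this line the K1 crux AND the `p = 2`
Greenberg–Vatsal `μ`-invariance for theta pairs rest on: Eichler–Shimura (depleted optimal quotient), Hecke self-duality, Buzzard's mod-`2`
multiplicity one, Serre 1972, the period fact at `2` (Abbes–Ullmo), and Ihara's lemma mod `2` in symbol form (Ribet 1984 Thm. 4.3 + Serre's
CSP; cite-grade port, the only unlanded non-PUB input; memo `Cruxes/MazurTateCongruenceAtTwoTop/K1ROW-LEAD-g11.md` §3–§3bis).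

References: [Ribet1984ICM] Thm. 4.1–4.3; [Serre1970SL2]; [GreenbergVatsal2000] Thm. (1.4), §3 (13), Rem. 3.4; [Vatsal1999] Thm. (1.10);
[Buzzard2000LevelLoweringModTwo] Prop. 2.4; [AbbesUllmo1996] Thm. A.
-/

-- justification: the `Summit.BirchSwinnertonDyer.BirchSwinnertonDyer.…` path repeats a component (route-file convention)
set_option linter.dupNamespace false
set_option autoImplicit false

noncomputable section

open scoped Classical MatrixGroups ModularForm

open CongruenceSubgroup Polynomial WeierstrassCurve NumberField IsDedekindDomain
  Literature.NumberTheory.IwasawaTheory Literature.NumberTheory.EllipticCurves Literature.NumberTheory.EllipticCurves.ModularForms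
  Literature.NumberTheory.EllipticCurves.Rank1Residual Literature.NumberTheory.EllipticCurves.GreenbergVatsal2000
  Summit.BirchSwinnertonDyer.Rank1Residual.Supersingular
  Summit.BirchSwinnertonDyer.BirchSwinnertonDyer.Theorems.ThetaLayerLambdaCongruenceAtTwo

namespace Summit.BirchSwinnertonDyer.BirchSwinnertonDyer.Theorems.MazurTateCongruenceAtTwoR

/-- **`MazurTateCongruenceAtTwoTop` (crux 25797 = 21416) BY NAME from the four named facts of the plus line, the period fact, and
(IH₂⁻) «Ihara's lemma mod `2` in symbol form (absolutely irreducible case)»** — `…_of_fourFacts_depletionPrimitiveNegDisc` ∘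
`stub_depletionPrimitiveNegDisc_of_ihara`. NO `μ = 0` / `μ`-invariance input. Nothing is asserted about (IH₂⁻); BSD is not proved by this.
[cite: Ribet1984ICM, Thm. 4.1 and Thm. 4.3] [cite: Serre1970SL2, Thm. 2] [cite: GreenbergVatsal2000, Thm. (1.4), §3 (13) and Remark 3.4]
[cite: Buzzard2000LevelLoweringModTwo, Prop. 2.4] -/
theorem mazurTateCongruenceAtTwoTop_of_fourFacts_ihara
    (hES : eichlerShimura_depletedOptimalQuotient_periodLattice_of_dvd) (hSD : heckeSelfDual_torsionBy_J0)
    (hBz : buzzard2000_multiplicityOne_gamma0) (hSe : serre1972_supersingular_decompositionSubgroup_image)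
    (h2 : realPeriodRat_eq_unit_mul_plusPeriod_two)
    (hIH : ∀ (W : WeierstrassCurve ℚ) [W.IsElliptic] [W.IsGloballyMinimal], GoodSS W 2 → W.Δ < 0 → ∀ (N' : ℕ), Odd N' →
      (∀ v : IsDedekindDomain.HeightOneSpectrum (NumberField.RingOfIntegers ℚ), ¬ ((Rat.HeightOneSpectrum.primesEquiv v : ℕ) ∣ 2 * N') → W.HasGoodReductionAt v) →
      ∀ (ℓ : ℕ), ℓ.Prime → ℓ ≠ 2 → ∀ (Φ : ℚ → PadicAlgCl 2),
      (∀ (r : ℚ) (z : ℤ), Φ (r + z) = Φ r) → (∀ r : ℚ, Φ (-r) = Φ r) → (∀ (γ : CongruenceSubgroup.Gamma0 (N')) (r : ℚ), ((γ : SL(2, ℤ)) 1 0 : ℚ) * r + ((γ : SL(2, ℤ)) 1 1 : ℚ) ≠ 0 → Φ ((((γ : SL(2, ℤ)) 0 0 : ℚ) * r + ((γ : SL(2, ℤ)) 0 1 : ℚ)) / (((γ : SL(2, ℤ)) 1 0 : ℚ) * r + ((γ : SL(2, ℤ)) 1 1 : ℚ))) = (if ((γ : SL(2, ℤ)) 1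 0) = 0 then 0 else Φ ((((γ : SL(2, ℤ)) 0 0 : ℚ)) / (((γ : SL(2, ℤ)) 1 0 : ℚ)))) + Φ r) →
      (∀ r : ℚ, ‖Φ r‖ ≤ 1) →
      (∀ q : ℕ, q.Prime → ¬ q ∣ 2 * N' * ℓ → ∀ r : ℚ, ‖(∑ j : Fin q, Φ ((r + j) / q)) + Φ (q * r) - (W.LFunction q : PadicAlgCl 2) * Φ r‖ < 1) →
      (∀ (r : ℚ) (j : ℤ) (n : ℕ), ‖Φ (r + j / (ℓ : ℚ) ^ n) - Φ r‖ < 1) →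
      ∀ r : ℚ, ‖Φ r‖ < 1) :
    Summit.BirchSwinnertonDyer.BirchSwinnertonDyer.Theses.ThetaPartnerAtTwo.MazurTateCongruenceAtTwoTop :=
  mazurTateCongruenceAtTwoTop_of_fourFacts_depletionPrimitiveNegDisc hES hSD hBz hSe h2 (stub_depletionPrimitiveNegDisc_of_ihara h2 hIH)

/-- **PUB⁵ + (IH₂⁻)**: the crux BY NAME from Eichler–Shimura (depleted optimal quotient), Hecke self-duality, Buzzard, Serre 1972, Abbes–Ullmo,
and Ihara's lemma mod `2` in symbol form. BSD is not proved by this. [cite: AbbesUllmo1996, Thm. A] [cite: Ribet1984ICM, Thm. 4.3] -/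
theorem mazurTateCongruenceAtTwoTop_of_fiveFacts_ihara
    (hES : eichlerShimura_depletedOptimalQuotient_periodLattice_of_dvd) (hSD : heckeSelfDual_torsionBy_J0)
    (hBz : buzzard2000_multiplicityOne_gamma0) (hSe : serre1972_supersingular_decompositionSubgroup_image)
    (hAU : abbesUllmo_not_dvd_maninConstant_of_not_dvd_level)
    (hIH : ∀ (W : WeierstrassCurve ℚ) [W.IsElliptic] [W.IsGloballyMinimal], GoodSS W 2 → W.Δ < 0 → ∀ (N' : ℕ), Odd N' →
      (∀ v : IsDedekindDomain.HeightOneSpectrum (NumberField.RingOfIntegers ℚ), ¬ ((Rat.HeightOneSpectrum.primesEquiv v : ℕ) ∣ 2 * N') → W.HasGoodReductionAt v) →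
      ∀ (ℓ : ℕ), ℓ.Prime → ℓ ≠ 2 → ∀ (Φ : ℚ → PadicAlgCl 2),
      (∀ (r : ℚ) (z : ℤ), Φ (r + z) = Φ r) → (∀ r : ℚ, Φ (-r) = Φ r) → (∀ (γ : CongruenceSubgroup.Gamma0 (N')) (r : ℚ), ((γ : SL(2, ℤ)) 1 0 : ℚ) * r + ((γ : SL(2, ℤ)) 1 1 : ℚ) ≠ 0 → Φ ((((γ : SL(2, ℤ)) 0 0 : ℚ) * r + ((γ : SL(2, ℤ)) 0 1 : ℚ)) / (((γ : SL(2, ℤ)) 1 0 : ℚ) * r + ((γ : SL(2, ℤ)) 1 1 : ℚ))) = (if ((γ : SL(2, ℤ)) 1 0) = 0 then 0 else Φ ((((γ : SL(2, ℤ)) 0 0 : ℚ)) / (((γ : SL(2, ℤ)) 1 0 : ℚ)))) + Φ r) →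
      (∀ r : ℚ, ‖Φ r‖ ≤ 1) →
      (∀ q : ℕ, q.Prime → ¬ q ∣ 2 * N' * ℓ → ∀ r : ℚ, ‖(∑ j : Fin q, Φ ((r + j) / q)) + Φ (q * r) - (W.LFunction q : PadicAlgCl 2) * Φ r‖ < 1) →
      (∀ (r : ℚ) (j : ℤ) (n : ℕ), ‖Φ (r + j / (ℓ : ℚ) ^ n) - Φ r‖ < 1) →
      ∀ r : ℚ, ‖Φ r‖ < 1) :
    Summit.BirchSwinnertonDyer.BirchSwinnertonDyer.Theses.ThetaPartnerAtTwo.MazurTateCongruenceAtTwoTop :=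
  mazurTateCongruenceAtTwoTop_of_fourFacts_ihara hES hSD hBz hSe
    (SkinnerUrban2014.realPeriodRat_eq_unit_mul_plusPeriod_two_fact_of_abbesUllmo hAU) hIH

/-- The twin `MazurTateCongruenceAtTwoR` (stmt-21416) BY NAME from PUB⁴ + the period fact + (IH₂⁻). BSD is not proved by this.
[cite: Ribet1984ICM, Thm. 4.3] [cite: GreenbergVatsal2000, §3 (13)] -/
theorem mazurTateCongruenceAtTwoR_of_fourFacts_ihara
    (hES : eichlerShimura_depletedOptimalQuotient_periodLattice_of_dvd) (hSD : heckeSelfDual_torsionBy_J0)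
    (hBz : buzzard2000_multiplicityOne_gamma0) (hSe : serre1972_supersingular_decompositionSubgroup_image)
    (h2 : realPeriodRat_eq_unit_mul_plusPeriod_two)
    (hIH : ∀ (W : WeierstrassCurve ℚ) [W.IsElliptic] [W.IsGloballyMinimal], GoodSS W 2 → W.Δ < 0 → ∀ (N' : ℕ), Odd N' →
      (∀ v : IsDedekindDomain.HeightOneSpectrum (NumberField.RingOfIntegers ℚ), ¬ ((Rat.HeightOneSpectrum.primesEquiv v : ℕ) ∣ 2 * N') → W.HasGoodReductionAt v) →
      ∀ (ℓ : ℕ), ℓ.Prime → ℓ ≠ 2 → ∀ (Φ : ℚ → PadicAlgCl 2),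
      (∀ (r : ℚ) (z : ℤ), Φ (r + z) = Φ r) → (∀ r : ℚ, Φ (-r) = Φ r) → (∀ (γ : CongruenceSubgroup.Gamma0 (N')) (r : ℚ), ((γ : SL(2, ℤ)) 1 0 : ℚ) * r + ((γ : SL(2, ℤ)) 1 1 : ℚ) ≠ 0 → Φ ((((γ : SL(2, ℤ)) 0 0 : ℚ) * r + ((γ : SL(2, ℤ)) 0 1 : ℚ)) / (((γ : SL(2, ℤ)) 1 0 : ℚ) * r + ((γ : SL(2, ℤ)) 1 1 : ℚ))) = (if ((γ : SL(2, ℤ)) 1 0) = 0 then 0 else Φ ((((γ : SL(2, ℤ)) 0 0 : ℚ)) / (((γ : SL(2, ℤ)) 1 0 : ℚ)))) + Φ r) →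
      (∀ r : ℚ, ‖Φ r‖ ≤ 1) →
      (∀ q : ℕ, q.Prime → ¬ q ∣ 2 * N' * ℓ → ∀ r : ℚ, ‖(∑ j : Fin q, Φ ((r + j) / q)) + Φ (q * r) - (W.LFunction q : PadicAlgCl 2) * Φ r‖ < 1) →
      (∀ (r : ℚ) (j : ℤ) (n : ℕ), ‖Φ (r + j / (ℓ : ℚ) ^ n) - Φ r‖ < 1) →
      ∀ r : ℚ, ‖Φ r‖ < 1) :
    Summit.BirchSwinnertonDyer.BirchSwinnertonDyer.Theses.ThetaPartnerAtTwo.MazurTateCongruenceAtTwoR :=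
  mazurTateCongruenceAtTwoTop_of_fourFacts_ihara hES hSD hBz hSe h2 hIH

/-- **Greenberg–Vatsal `μ`-invariance at `2` on the theta habitat from PUB⁴ + the period fact + (IH₂⁻)** (memo A6): for every theta pair,
newforms and Pollack pairs at `2`, `L♭_W` has a unit coefficient iff `L♭_A` does — the crux (from Ihara) fed into the converse
`flatIff_of_mazurTateCongruenceAtTwoTop` (`…RMuInvariance`). So the `p = 2` analogue of [GreenbergVatsal2000, Thm. (1.4)] for these pairs rests on
print-grade inputs only. Nothing is asserted about the named facts or (IH₂⁻); BSD is not proved by this.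
[cite: GreenbergVatsal2000, Thm. (1.4) and §3 (13)] [cite: Ribet1984ICM, Thm. 4.3] [cite: Vatsal1999, Thm. (1.10)] -/
theorem muInvarianceAtTwo_of_fourFacts_ihara
    (hES : eichlerShimura_depletedOptimalQuotient_periodLattice_of_dvd) (hSD : heckeSelfDual_torsionBy_J0)
    (hBz : buzzard2000_multiplicityOne_gamma0) (hSe : serre1972_supersingular_decompositionSubgroup_image)
    (h2 : realPeriodRat_eq_unit_mul_plusPeriod_two)
    (hIH : ∀ (W : WeierstrassCurve ℚ) [W.IsElliptic] [W.IsGloballyMinimal], GoodSS W 2 → W.Δ < 0 → ∀ (N' : ℕ), Odd N' →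
      (∀ v : IsDedekindDomain.HeightOneSpectrum (NumberField.RingOfIntegers ℚ), ¬ ((Rat.HeightOneSpectrum.primesEquiv v : ℕ) ∣ 2 * N') → W.HasGoodReductionAt v) →
      ∀ (ℓ : ℕ), ℓ.Prime → ℓ ≠ 2 → ∀ (Φ : ℚ → PadicAlgCl 2),
      (∀ (r : ℚ) (z : ℤ), Φ (r + z) = Φ r) → (∀ r : ℚ, Φ (-r) = Φ r) → (∀ (γ : CongruenceSubgroup.Gamma0 (N')) (r : ℚ), ((γ : SL(2, ℤ)) 1 0 : ℚ) * r + ((γ : SL(2, ℤ)) 1 1 : ℚ) ≠ 0 → Φ ((((γ : SL(2, ℤ)) 0 0 : ℚ) * r + ((γ : SL(2, ℤ)) 0 1 : ℚ)) / (((γ : SL(2, ℤ)) 1 0 : ℚ) * r + ((γ : SL(2, ℤ)) 1 1 : ℚ))) = (if ((γ : SL(2, ℤ)) 1 0) = 0 then 0 else Φ ((((γ : SL(2, ℤ)) 0 0 : ℚ)) / (((γ : SL(2, ℤ)) 1 0 : ℚ)))) + Φ r) →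
      (∀ r : ℚ, ‖Φ r‖ ≤ 1) →
      (∀ q : ℕ, q.Prime → ¬ q ∣ 2 * N' * ℓ → ∀ r : ℚ, ‖(∑ j : Fin q, Φ ((r + j) / q)) + Φ (q * r) - (W.LFunction q : PadicAlgCl 2) * Φ r‖ < 1) →
      (∀ (r : ℚ) (j : ℤ) (n : ℕ), ‖Φ (r + j / (ℓ : ℚ) ^ n) - Φ r‖ < 1) →
      ∀ r : ℚ, ‖Φ r‖ < 1) :
    ∀ (W : WeierstrassCurve ℚ) [W.IsElliptic] [W.IsGloballyMinimal] (A : WeierstrassCurve ℚ) [A.IsElliptic]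
      [A.IsGloballyMinimal], ¬ W.HasCM → W.analyticRank = 0 → GoodSS W 2 → W.frobeniusTrace 2 = 0 → A.HasCM → GoodSS A 2 →
      A.frobeniusTrace 2 = 0 →
      (∃ e : geomTorsion W (2 : ℤ) ≃+ geomTorsion A (2 : ℤ),
        ∀ (σ : Field.absoluteGaloisGroup ℚ) (P : geomTorsion W (2 : ℤ)), e (σ • P) = σ • e P) →
      ∀ [NeZero (W.conductorNorm ℤ)] (f : CuspForm (Gamma0 (W.conductorNorm ℤ)) 2), IsNewformOf W f →
      ∀ (Lplus Lminus : IwasawaAlgebra 2), IsPollackPair f 2 Lplus Lminus →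
      ∀ [NeZero (A.conductorNorm ℤ)] (fA : CuspForm (Gamma0 (A.conductorNorm ℤ)) 2), IsNewformOf A fA →
      ∀ (LplusA LminusA : IwasawaAlgebra 2), IsPollackPair fA 2 LplusA LminusA →
      ((∃ n : ℕ, IsUnit (PowerSeries.coeff n (kobayashiL 1 Lplus Lminus))) ↔
        (∃ n : ℕ, IsUnit (PowerSeries.coeff n (kobayashiL 1 LplusA LminusA)))) :=
  flatIff_of_mazurTateCongruenceAtTwoTop h2 (mazurTateCongruenceAtTwoTop_of_fourFacts_ihara hES hSD hBz hSe h2 hIH)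

end Summit.BirchSwinnertonDyer.BirchSwinnertonDyer.Theorems.MazurTateCongruenceAtTwoR

end
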